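/-
Copyright: public-audit package `pub-balaban` (b2b-balaban), seat pv28-g9. Released under Apache 2.0 like Mathlib.
-/
import Literature.MathematicalPhysics.QuantumFieldTheory.Balaban1983to89.T4CovarianceResponse
import Literature.MathematicalPhysics.QuantumFieldTheory.Balaban1983to89.T4CubePoincare

/-!
# T4 — chart transport of the cube Brascamp–Lieb bound to the group fibre

`Literature/MathematicalPhysics/QuantumFieldTheory/Balaban1983to89/`, namespace
`Literature.MathematicalPhysics.QuantumFieldTheory.Balaban1983to89.T4CubeChartTransport`.
Row `T4-O3.E-iii-b-G7-BLWINDOW°` of the pub-balaban cell (lineage pv28, gen 9; the row re-scoped and yielded by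
pv16 gen 11, cell records GAPS G-pv16g11-6 (β1)–(β4), `t4/T4-EST-O3Eiiib-G7.md` §2quinquies).
Versions: v1 (§1–§2), v1.1 (+ §3, append-only), v1.2 (pv28 gen 10: DOCSTRING-ONLY — census, caveats (CHART) and (γ),
the §3 pointer — after the cross-read recorded as cell GAPS C-pv24g9-10; every declaration byte-identical to v1.1),
v1.3 (pv28 gen 10: + §4 «vector inserts», APPEND-ONLY — the declarations of §1–§3 byte-identical to v1.2; caveat
(REAL) typed).

## HONEST FRAMING

Nothing in this file is printed in Bałaban's papers and nothing here is asserted about any of his densities, windows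
or exponents.  It is a **[folklore] corollary of tree facts used BY NAME**: it closes the typed seam between

* the ENGINE `T4CubePoincare.cubeVar_le_of_grad_le` (pv16 gen 11): for a windowed Gibbs law `∝ e^{-f} 1_K dx` on the
  cube `K = [-S,S]ⁿ ⊂ ℝⁿ`, `f ∈ C²(ℝⁿ)` with coordinate Hessian `≥ λ·1`, `g ∈ C¹` with `|∇g|² ≤ G²` on `K`:
  `Var(g) ≤ λ⁻¹ G²`; and
* the CONSUMER `T4CovarianceResponse.respDom` / `….meanLipschitz_of_varianceBound` (pv16 gen 11): the exterior
  `u` of the one-step fibre `(s → G)` lies in the response domain as soon as the PATH VARIANCES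
  `pathVar s χ h u₀ u F θ` (`θ ∈ [0,1]`) of the exponent gap and of the bond inserts are `≤ (σ·dev u)²`, `≤ τ²`,

by a CHANGE OF VARIABLES HYPOTHESIS (`IsCubeImage` / `CubeChart`): the windowed base law of the fibre at the
reference exterior, `χ(u₀←y) · Haar^s(dy)`, is the image under a measurable chart `φ : ℝⁿ → (s → G)` of the weighted
Lebesgue law `e^{-jac} 1_K dx` on a cube.  Under it every normalised Gibbs integral on the fibre with density
`χ(u₀←·) e^{H}` is the corresponding integral against `T4CubePoincare.cubeLaw f S`, `f = jac − H∘φ` on `K`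
(`IsCubeImage.integral_normLaw_exp_eq_integral_cubeLaw`), the path variance IS a cube variance of the interpolated
exponent `(1−θ) f₀ + θ f₁` (`pathVar_eq_cubeVar`), and the engine's bound lands in the consumer's slots with
`σ = b_H/√λ`, `τ = L/√λ` (`mem_respDom_of_cubeChart`).  Neither the engine nor the consumer is re-proved or modified.

## CITATION HEADER

No page of Bałaban's papers or of [BrascampLieb1976] was read for this file; every declaration is tagged [folklore]
(change of variables for push-forward measures with density, Mathlib's `integral_map` / `integral_withDensity…`, and
bookkeeping).  0 [cite], 0 [model].

## WHAT IS PROVED (CENSUS: 34 declarations — 1 structure, 2 definitions, 1 abbreviation, 30 theorems (§1–§3: 17 as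
in v1.1/v1.2; §4: 1 definition + 16 theorems); axioms {propext, Classical.choice, Quot.sound}; 0 sorry)

* §1 (abstract, any measurable space `Y`, any measure `ν`): `IsCubeImage ν w n S φ jac` — the weighted law `w dν` is
  `φ_*(e^{-jac} 1_K dx)`; its trivial instance `isCubeImage_indicator` (the weighted cube on `ℝⁿ`, `φ = id`: the
  setting of `T4CubePoincare`; non-vacuity); transport of weighted integrals (`integral_mul_eq`), of normalised laws
  (`integral_normLaw_mul_eq`, `integral_normLaw_exp_eq_integral_cubeLaw`) and of variances
  (`variance_normLaw_exp_eq_cubeVar`); congruence of `cubeMean`/`cubeVar` in the insert on the window.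
* §2 (the one-step fibre of `B15.BasicStep`): `CubeChart s χ u₀ n S φ jac := IsCubeImage (fibreBase s) (χ(u₀←·)) …`;
  `pathVar_eq_integral` (the path variance of a REAL insert written out), `integrable_interpDensity`,
  `pathVar_eq_cubeVar`, and the plug `mem_respDom_of_cubeChart`: blind window + bounded gap + `0 ≤ dev u` +
  `λ > 0` + `C²` representatives `f₀, f₁` of `jac − h(u₀←φ·)`, `jac − h(u←φ·)` on `K` with `HessianBound fᵢ λ` +
  `|∇(f₁ − f₀)|² ≤ (b_H · dev u)²` on `K` + `C¹` representatives of the inserts with `|∇|² ≤ L²` on `K`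
  ⟹ `u ∈ respDom s χ h u₀ B T dev (b_H/√λ) (L/√λ)`.
* §3 (v1.1): `respDom_mono` (monotone in `(σ, τ)`), `mem_respDom_of_forall_gt` (the two variance slots of `respDom`
  are CLOSED conditions), `mem_respDom_of_forall_lt_modulus` (membership at every `λ' ∈ (0, λ)` gives membership at
  `λ`) — the `ε ↓ 0` step of caveat (EXT).
* §4 (v1.3, inserts with values in a real Banach space `E`): `NormSqDominated ℓ c` (`‖v‖² ≤ c·Σ_i (ℓ i v)²` for a
  finite family of continuous linear functionals; `c = 1` for the coordinates of `EuclideanSpace ℝ ι` —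
  `normSqDominated_euclidean`, with equality `norm_sq_eq_sum_euclidean` — and of `ι → ℝ` with the sup norm —
  `normSqDominated_pi`); under `TiltData` on a finite measure space and for BOUNDED a.e.-strongly-measurable inserts:
  `integrable_tiltLaw_of_bound`, `apply_tiltMean_eq` (`ℓ(E_θ F) = E_θ(ℓ∘F)`), `integrable_sq_dev_apply`, the
  COMPONENTWISE REDUCTION `tiltVar_le_sum_apply` (`Var_θ F ≤ c·Σ_i Var_θ(ℓ i∘F)`), `tiltVar_eq_sum_apply` (`=` for
  norm-reproducing coordinates), `tiltVar_apply_le` (`Var_θ(ℓ∘F) ≤ ‖ℓ‖²·Var_θ F`); on the fibre `pathVar_le_sum_apply`,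
  `pathVar_eq_sum_apply`, `mem_respDom_of_apply` (membership of `u` in `respDom` for the SCALAR component inserts
  `(b, i) ↦ ℓ i (B·b)` over `T ×ˢ univ` with modulus `τ` ⟹ membership for the `E`-valued inserts `B·b` with modulus
  `√(c·#ι)·τ`), the converse `mem_respDom_apply_of_mem` (modulus `M·τ` for `‖ℓ i‖ ≤ M`), and the plugs
  `mem_respDom_of_cubeChart_apply` / `…_euclidean` / `…_pi` (per-component `C¹` representatives with `|∇|² ≤ L²` on
  `K` ⟹ `u ∈ respDom s χ h u₀ B T dev (b_H/√λ) (√(c·#ι)·(L/√λ))`, `c = 1` in the two coordinate cases).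

## CAVEATS (located, not discharged)

* (CHART) `IsCubeImage` is a HYPOTHESIS.  Its instantiation — `φ` = exponential coordinates of `G^s` about the
  minimiser, `K` = a sup-norm Lie-algebra window (a product over `b ∈ s` of sup-norm balls of common radius in
  `𝔤 ≅ ℝ^{dim 𝔤}` IS a cube; a Hilbert–Schmidt-ball window is NOT), `e^{-jac}` = the Haar density in these
  coordinates, `χ(u₀←·)` = the {0,1}-valued window function supported exactly on `φ(K)` — is NOT in the tree for
  `SU(N)`, `N ≥ 2`.  `U(1)`: exact with `jac` constant — typed (v1.2 pointer) for the cell's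
  `Matrix.unitaryGroup (Fin 1) ℂ` in `T4CubeChartCircle.cubeChart_unitaryOne` (polar chart about `u₀`, product arc
  window of half-width `S < π`, `jac ≡ n log 2π`).  A smooth cutoff `χ` is not of this shape unless absorbed into `jac`.
* (EXT) `T4CubePoincare.HessianBound` and `ContDiff ℝ 2` are GLOBAL on `ℝⁿ`; the transported exponent is only given
  on `K`, so convexity is asked of `C²` REPRESENTATIVES `f₀, f₁` agreeing with it on `K`.  The extension lemma
  (a `λ`-convex `C²` function on a neighbourhood of `K` has such a representative, possibly with a smaller `λ`) is NOT
  typed here.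
* (REAL) In §2 the inserts are real-valued (`E := ℝ` in `respDom`); vector inserts reduce componentwise (record (β4)) —
  TYPED in §4 (v1.3) for bounded inserts with values in any real Banach space carrying a finite norm-square-dominating
  family of functionals (Euclidean and sup-norm coordinates: factor `√#ι` in the insert modulus), at the price of the
  printed proviso `fibreIntegral … u₀ ≠ 0` (positivity of the window mass, needed for the Bochner mean of the vector
  insert; §2 does not need it) and of a uniform bound on the inserts (as in `meanLipschitz_of_varianceBound`).
* (γ) The located inputs — `λ = (CONCAVITY modulus of h∘φ on K, i.e. the convexity modulus of the transported
  exponent −h∘φ = (1/g²)·A_eff∘φ in Bałaban's normalisation `e^{h} = e^{-A_eff/g²}`) + inf_K Hess(jac)` (the law is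
  `∝ e^{-f} 1_K dx` with `f = jac − h∘φ`, so `Hess f ≥ inf Hess(jac) − sup Hess(h∘φ)`; v1.2 wording, v1–v1.1 had the
  sign of both terms reversed) uniformly in the step, `b_H`, `L`, the window radius — are Bałaban-side facts about
  his exponents (cell record `t4/T4-EST-O3Eiiib-G7.md` §2quinquies (γ)); nothing here sizes them.
* Value = kernel certificate that the (VAR) slots of the covariance response are fed by the cube Brascamp–Lieb engine
  through one explicit change-of-variables hypothesis — NOT summit progress.
-/

noncomputable section

open _root_.MeasureTheory
open Function (updateFinset)
open scoped ENNReal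

namespace Literature.MathematicalPhysics.QuantumFieldTheory.Balaban1983to89.T4CubeChartTransport

open Literature.Probability.Distributions (coordGradient)
open B15.BasicStep T4DressingDefect T4CoReadMoment T4TiltModulus T4CovarianceResponse T4CubePoincare

/-! ## §1  Abstract transport: a weighted law that is the chart image of a weighted cube -/

section Abstract

variable {Y : Type*} [MeasurableSpace Y] {ν : Measure Y} {w : Y → ℝ} {n : ℕ} {S : ℝ}
  {φ : (Fin n → ℝ) → Y} {jac : (Fin n → ℝ) → ℝ}

/-- The weighted Lebesgue law `e^{-jac} 1_K dx` of the cube `K = [-S,S]ⁿ`, as a measure on `ℝⁿ`. [folklore] -/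
def cubeWeighted (n : ℕ) (S : ℝ) (jac : (Fin n → ℝ) → ℝ) : Measure (Fin n → ℝ) :=
  (volume.restrict (cube n S)).withDensity fun x => ENNReal.ofReal (Real.exp (-jac x))

/-- **THE CHART HYPOTHESIS.**  The weighted law `w dν` on `Y` is the image under the measurable chart `φ` of the
weighted Lebesgue law `e^{-jac} 1_{[-S,S]ⁿ} dx` (`S > 0`, `w ≥ 0` measurable, `jac` measurable).  For the one-step
fibre: `Y = (s → G)`, `ν` = product Haar, `w = χ(u₀←·)` the window, `φ` = exponential coordinates, `e^{-jac}` = the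
Haar density (caveat (CHART)). [folklore] -/
structure IsCubeImage (ν : Measure Y) (w : Y → ℝ) (n : ℕ) (S : ℝ) (φ : (Fin n → ℝ) → Y)
    (jac : (Fin n → ℝ) → ℝ) : Prop where
  /-- the window is a genuine cube -/
  S_pos : 0 < S
  /-- the weight is measurable … -/
  measurable_w : Measurable w
  /-- … and non-negative -/
  nonneg_w : ∀ y, 0 ≤ w y
  /-- the chart is measurable -/
  measurable_φ : Measurable φ
  /-- the log-Jacobian is measurable -/
  measurable_jac : Measurable jac
  /-- the change-of-variables identity -/
  map_eq : ν.withDensity (fun y => ENNReal.ofReal (w y)) = Measure.map φ (cubeWeighted n S jac)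

/-- NON-VACUITY / THE EUCLIDEAN MODEL: the weighted cube `e^{-jac} 1_K dx` on `ℝⁿ` is its own chart image
(`φ = id`) — the setting of `T4CubePoincare` is the trivial instance of the chart hypothesis. [folklore] -/
theorem isCubeImage_indicator (hS : 0 < S) (hjac : Measurable jac) :
    IsCubeImage (volume : Measure (Fin n → ℝ)) ((cube n S).indicator fun x => Real.exp (-jac x)) n S id jac where
  S_pos := hS
  measurable_w := (Real.measurable_exp.comp hjac.neg).indicator (measurableSet_cube' n S)
  nonneg_w x := Set.indicator_nonneg (fun _ _ => (Real.exp_pos _).le) x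
  measurable_φ := measurable_id
  measurable_jac := hjac
  map_eq := by
    have hfun : (fun y => ENNReal.ofReal ((cube n S).indicator (fun x => Real.exp (-jac x)) y)) =
        (cube n S).indicator fun x => ENNReal.ofReal (Real.exp (-jac x)) := by
      funext x
      by_cases hx : x ∈ cube n S
      · rw [Set.indicator_of_mem hx, Set.indicator_of_mem hx]
      · rw [Set.indicator_of_notMem hx, Set.indicator_of_notMem hx, ENNReal.ofReal_zero]
    rw [hfun, withDensity_indicator (measurableSet_cube' n S), Measure.map_id, cubeWeighted]

/-- TRANSPORT OF WEIGHTED INTEGRALS: `∫ w ψ dν = ∫_K e^{-jac} ψ∘φ dx` for measurable real `ψ`. [folklore] -/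
theorem IsCubeImage.integral_mul_eq (hc : IsCubeImage ν w n S φ jac) {ψ : Y → ℝ} (hψ : Measurable ψ) :
    ∫ y, w y * ψ y ∂ν = ∫ x in cube n S, Real.exp (-jac x) * ψ (φ x) := by
  have h1 : ∫ y, w y * ψ y ∂ν = ∫ y, ψ y ∂ν.withDensity (fun y => ENNReal.ofReal (w y)) := by
    rw [integral_withDensity_eq_integral_toReal_smul hc.measurable_w.ennreal_ofReal
      (ae_of_all _ fun _ => ENNReal.ofReal_lt_top)]
    refine integral_congr_ae (ae_of_all _ fun y => ?_)
    dsimp only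
    rw [ENNReal.toReal_ofReal (hc.nonneg_w y), smul_eq_mul]
  have hm : Measurable fun x : Fin n → ℝ => ENNReal.ofReal (Real.exp (-jac x)) :=
    (Real.measurable_exp.comp hc.measurable_jac.neg).ennreal_ofReal
  have h2 : ∫ x in cube n S, Real.exp (-jac x) * ψ (φ x) = ∫ x, ψ (φ x) ∂cubeWeighted n S jac := by
    rw [cubeWeighted, integral_withDensity_eq_integral_toReal_smul hm
      (ae_of_all _ fun _ => ENNReal.ofReal_lt_top)]
    refine integral_congr_ae (ae_of_all _ fun x => ?_)
    dsimp only
    rw [ENNReal.toReal_ofReal (Real.exp_pos _).le, smul_eq_mul]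
  rw [h1, h2, hc.map_eq, integral_map_of_stronglyMeasurable hc.measurable_φ hψ.stronglyMeasurable]

/-- TRANSPORT OF NORMALISED LAWS: for a measurable weight factor `r ≥ 0` with `w·r` integrable and a measurable real
insert `F`, `∫ F d(normLaw ν (w·r)) = (∫_K e^{-jac} (r F)∘φ) / ∫_K e^{-jac} r∘φ`. [folklore] -/
theorem IsCubeImage.integral_normLaw_mul_eq (hc : IsCubeImage ν w n S φ jac) {r : Y → ℝ} (hrm : Measurable r)
    (hr0 : ∀ y, 0 ≤ r y) (hint : Integrable (fun y => w y * r y) ν) {F : Y → ℝ} (hF : Measurable F) :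
    ∫ y, F y ∂normLaw ν (fun y => w y * r y) =
      (∫ x in cube n S, Real.exp (-jac x) * (r (φ x) * F (φ x))) /
        ∫ x in cube n S, Real.exp (-jac x) * r (φ x) := by
  rw [integral_normLaw (p := fun y => w y * r y) (hc.measurable_w.mul hrm)
    (fun y => mul_nonneg (hc.nonneg_w y) (hr0 y)) hint F]
  have hZ : ∫ t, w t * r t ∂ν = ∫ x in cube n S, Real.exp (-jac x) * r (φ x) := hc.integral_mul_eq hrm
  have hN : ∫ y, w y * (r y * F y) ∂ν = ∫ x in cube n S, Real.exp (-jac x) * (r (φ x) * F (φ x)) :=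
    hc.integral_mul_eq (hrm.mul hF)
  rw [← hZ, ← hN, ← integral_div]
  refine integral_congr_ae (ae_of_all _ fun y => ?_)
  simp only [smul_eq_mul]
  ring

/-- TRANSPORT TO THE WINDOWED GIBBS LAW OF THE CUBE: with an exponential weight factor `e^{H}` and any `f` agreeing
with `jac − H∘φ` on `K`, `∫ F d(normLaw ν (w e^{H})) = ∫ F∘φ d(cubeLaw f S)`. [folklore] -/
theorem IsCubeImage.integral_normLaw_exp_eq_integral_cubeLaw (hc : IsCubeImage ν w n S φ jac) {H : Y → ℝ}
    (hHm : Measurable H) (hint : Integrable (fun y => w y * Real.exp (H y)) ν) {f : (Fin n → ℝ) → ℝ}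
    (hf : ∀ x ∈ cube n S, f x = jac x - H (φ x)) {F : Y → ℝ} (hF : Measurable F) :
    ∫ y, F y ∂normLaw ν (fun y => w y * Real.exp (H y)) = ∫ x, F (φ x) ∂cubeLaw f S := by
  rw [hc.integral_normLaw_mul_eq (r := fun y => Real.exp (H y)) (Real.measurable_exp.comp hHm)
    (fun y => (Real.exp_pos _).le) hint hF, integral_cubeLaw]
  have key : ∀ x ∈ cube n S, Real.exp (-jac x) * Real.exp (H (φ x)) = Real.exp (-f x) := fun x hx => by
    rw [← Real.exp_add, hf x hx]
    congr 1
    ring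
  unfold cubeMass
  congr 1
  · refine setIntegral_congr_fun (measurableSet_cube' n S) fun x hx => ?_
    show Real.exp (-jac x) * (Real.exp (H (φ x)) * F (φ x)) = F (φ x) * Real.exp (-f x)
    rw [← key x hx]
    ring
  · exact setIntegral_congr_fun (measurableSet_cube' n S) fun x hx => key x hx

/-- TRANSPORT OF VARIANCES: under the same data the variance of a measurable real insert `F` under
`normLaw ν (w e^{H})` IS the cube variance `T4CubePoincare.cubeVar f S (F∘φ)`. [folklore] -/
theorem IsCubeImage.variance_normLaw_exp_eq_cubeVar (hc : IsCubeImage ν w n S φ jac) {H : Y → ℝ}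
    (hHm : Measurable H) (hint : Integrable (fun y => w y * Real.exp (H y)) ν) {f : (Fin n → ℝ) → ℝ}
    (hf : ∀ x ∈ cube n S, f x = jac x - H (φ x)) {F : Y → ℝ} (hF : Measurable F) :
    ∫ y, (F y - ∫ t, F t ∂normLaw ν (fun y => w y * Real.exp (H y))) ^ 2
        ∂normLaw ν (fun y => w y * Real.exp (H y)) = cubeVar f S (fun x => F (φ x)) := by
  have h1 : ∫ t, F t ∂normLaw ν (fun y => w y * Real.exp (H y)) = ∫ x, F (φ x) ∂cubeLaw f S :=
    hc.integral_normLaw_exp_eq_integral_cubeLaw hHm hint hf hF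
  have h2 : ∫ y, (F y - ∫ x, F (φ x) ∂cubeLaw f S) ^ 2 ∂normLaw ν (fun y => w y * Real.exp (H y)) =
      ∫ x, (F (φ x) - ∫ x, F (φ x) ∂cubeLaw f S) ^ 2 ∂cubeLaw f S :=
    hc.integral_normLaw_exp_eq_integral_cubeLaw hHm hint hf ((hF.sub_const _).pow_const 2)
  rw [h1]
  exact h2.trans (variance_cubeLaw_eq f S fun x => F (φ x))

/-- `cubeMean` only sees the insert on the window. [folklore] -/
theorem cubeMean_congr_on {f g g' : (Fin n → ℝ) → ℝ} (hg : ∀ x ∈ cube n S, g x = g' x) :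
    cubeMean f S g = cubeMean f S g' :=
  congrArg (· / cubeMass f S) (setIntegral_congr_fun (measurableSet_cube' n S) fun x hx => by
    simp only [hg x hx])

/-- `cubeVar` only sees the insert on the window. [folklore] -/
theorem cubeVar_congr_on {f g g' : (Fin n → ℝ) → ℝ} (hg : ∀ x ∈ cube n S, g x = g' x) :
    cubeVar f S g = cubeVar f S g' := by
  have hm : cubeMean f S g = cubeMean f S g' := cubeMean_congr_on hg
  unfold cubeVar
  rw [hm]
  exact congrArg (· / cubeMass f S) (setIntegral_congr_fun (measurableSet_cube' n S) fun x hx => by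
    simp only [hg x hx])

end Abstract

/-! ## §2  The one-step fibre: path variances as cube variances, and the plug into `respDom` -/

section Fibre

variable {P : Params} {j : ℕ} {G : Type*} [GaugeGroup G] [MeasurableSpace G] [HaarData G]
variable [DecidableEq (PBond P j)]
variable {s : Finset (PBond P j)} {χ : Density P j G} {u₀ : GaugeField P j G} {n : ℕ} {S : ℝ}
  {φ : (Fin n → ℝ) → (s → G)} {jac : (Fin n → ℝ) → ℝ}

/-- **THE CHART HYPOTHESIS ON THE FIBRE** through `s` at the reference exterior `u₀`: the windowed base law
`χ(u₀←y) · (fibreBase s)(dy)` is the chart image of `e^{-jac} 1_{[-S,S]ⁿ} dx` (caveat (CHART)). [folklore] -/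
abbrev CubeChart (s : Finset (PBond P j)) (χ : Density P j G) (u₀ : GaugeField P j G) (n : ℕ) (S : ℝ)
    (φ : (Fin n → ℝ) → (s → G)) (jac : (Fin n → ℝ) → ℝ) : Prop :=
  IsCubeImage (fibreBase s) (fun y => χ (updateFinset u₀ s y)) n S φ jac

/-- The path variance of a REAL insert, written out: `∫ (F − ∫F dP_θ)² dP_θ`, `P_θ = pathLaw s χ h u₀ u θ`.
[folklore] -/
theorem pathVar_eq_integral (s : Finset (PBond P j)) (χ h : Density P j G) (u₀ u : GaugeField P j G)
    (F : (s → G) → ℝ) (θ : ℝ) :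
    pathVar s χ h u₀ u F θ = ∫ y, (F y - ∫ t, F t ∂pathLaw s χ h u₀ u θ) ^ 2 ∂pathLaw s χ h u₀ u θ := by
  simp only [pathVar, tiltVar, tiltMean, pathLaw, Real.norm_eq_abs, sq_abs]

/-- The interpolated Gibbs density `χ(u₀←·) e^{(1−θ)h(u₀←·) + θ h(u←·)}` of `pathLaw_eq_normLaw_interp` is
integrable against the base law, for `0 ≤ χ`, `χe^{h} ≤ C` and a bounded exponent gap. [folklore] -/
theorem integrable_interpDensity (s : Finset (PBond P j)) {χ h : Density P j G} (hχm : Measurable χ)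
    (hhm : Measurable h) (hχ0 : ∀ U, 0 ≤ χ U) {C : ℝ} (hC : ∀ U, χ U * Real.exp (h U) ≤ C)
    (u₀ u : GaugeField P j G) {K : ℝ} (hK : ∀ y : s → G, |h (updateFinset u₀ s y) - h (updateFinset u s y)| ≤ K)
    (θ : ℝ) :
    Integrable (fun y : s → G => χ (updateFinset u₀ s y) *
      Real.exp ((1 - θ) * h (updateFinset u₀ s y) + θ * h (updateFinset u s y))) (fibreBase s) := by
  have heq : (fun y : s → G => χ (updateFinset u₀ s y) *
      Real.exp ((1 - θ) * h (updateFinset u₀ s y) + θ * h (updateFinset u s y))) =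
      expTilt (fibreDensity s (fun U => χ U * Real.exp (h U)) u₀) (expGap s h u₀ u) θ :=
    funext fun y => (expTilt_fibreDensity_apply s χ h u₀ u θ y).symm
  rw [heq]
  have hq0 : ∀ y, 0 ≤ fibreDensity s (fun U => χ U * Real.exp (h U)) u₀ y :=
    fun y => mul_nonneg (hχ0 _) (Real.exp_nonneg _)
  have hgm : Measurable (expGap s h u₀ u) :=
    (hhm.comp measurable_updateFinset).sub (hhm.comp measurable_updateFinset)
  refine integrable_of_abs_le (measurable_expTilt
    (measurable_fibreDensity s (hχm.mul (Real.measurable_exp.comp hhm)) u₀) hgm θ).aestronglyMeasurable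
    (C := Real.exp (|θ| * K) * C) fun y => ?_
  rw [abs_of_nonneg (expTilt_nonneg hq0 _ θ y)]
  exact (expTilt_le hq0 hK θ y).trans (mul_le_mul_of_nonneg_left (hC _) (Real.exp_nonneg _))

/-- **PATH VARIANCES ARE CUBE VARIANCES.**  Under the chart hypothesis at `u₀`, for `C`-bounded measurable Gibbs data
with bounded gap and ANY functions `f₀, f₁` agreeing on `K` with the transported endpoint exponents
`jac − h(u₀←φ·)`, `jac − h(u←φ·)`: the path variance at `θ` of a measurable real insert `F` is the cube variance of
`F∘φ` under the interpolated exponent `(1−θ) f₀ + θ f₁`. [folklore] -/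
theorem pathVar_eq_cubeVar (hc : CubeChart s χ u₀ n S φ jac) {h : Density P j G} (hχm : Measurable χ)
    (hhm : Measurable h) (hχ0 : ∀ U, 0 ≤ χ U) {C : ℝ} (hC : ∀ U, χ U * Real.exp (h U) ≤ C)
    {u : GaugeField P j G} {K : ℝ} (hK : ∀ y : s → G, |h (updateFinset u₀ s y) - h (updateFinset u s y)| ≤ K)
    {f₀ f₁ : (Fin n → ℝ) → ℝ} (agree₀ : ∀ x ∈ cube n S, f₀ x = jac x - h (updateFinset u₀ s (φ x)))
    (agree₁ : ∀ x ∈ cube n S, f₁ x = jac x - h (updateFinset u s (φ x))) {F : (s → G) → ℝ}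
    (hF : Measurable F) {θ : ℝ} :
    pathVar s χ h u₀ u F θ = cubeVar (fun x => (1 - θ) * f₀ x + θ * f₁ x) S (fun x => F (φ x)) := by
  rw [pathVar_eq_integral, pathLaw_eq_normLaw_interp]
  refine hc.variance_normLaw_exp_eq_cubeVar
    (H := fun y => (1 - θ) * h (updateFinset u₀ s y) + θ * h (updateFinset u s y))
    (((hhm.comp measurable_updateFinset).const_mul _).add ((hhm.comp measurable_updateFinset).const_mul _))
    (integrable_interpDensity s hχm hhm hχ0 hC u₀ u hK θ) (fun x hx => ?_) hF
  rw [agree₀ x hx, agree₁ x hx]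
  ring

/-- **THE PLUG: the cube Brascamp–Lieb engine feeds the (VAR) slots of the covariance response.**  Under the chart
hypothesis at `u₀`, `C`-bounded measurable Gibbs data `0 ≤ χ`, `χe^{h} ≤ C`, an exterior `u` with blind window and
`K`-bounded gap, `0 ≤ dev u`, `λ > 0`, `C²` representatives `f₀, f₁` of the transported endpoint exponents with
`HessianBound fᵢ λ`, the gap-gradient bound `|∇(f₁ − f₀)|² ≤ (b_H · dev u)²` on `K`, and `C¹` representatives of the
real inserts `B · b` (`b ∈ T`) with `|∇|² ≤ L²` on `K`:  `u ∈ respDom s χ h u₀ B T dev (b_H/√λ) (L/√λ)` — by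
`T4CubePoincare.cubeVar_le_of_grad_le` along the path (`hessianBound_interp_Icc`). [folklore] -/
theorem mem_respDom_of_cubeChart {β : Type*} (hc : CubeChart s χ u₀ n S φ jac) {h : Density P j G}
    (hχm : Measurable χ) (hhm : Measurable h) (hχ0 : ∀ U, 0 ≤ χ U) {C : ℝ} (hC : ∀ U, χ U * Real.exp (h U) ≤ C)
    {u : GaugeField P j G} (hbl : ∀ y : s → G, χ (updateFinset u s y) = χ (updateFinset u₀ s y)) {K : ℝ}
    (hK : ∀ y : s → G, |h (updateFinset u₀ s y) - h (updateFinset u s y)| ≤ K) {dev : GaugeField P j G → ℝ}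
    (hdev : 0 ≤ dev u) {lam : ℝ} (hlam : 0 < lam) {f₀ f₁ : (Fin n → ℝ) → ℝ} (hf₀ : ContDiff ℝ 2 f₀)
    (hf₁ : ContDiff ℝ 2 f₁) (hB₀ : HessianBound f₀ lam) (hB₁ : HessianBound f₁ lam)
    (agree₀ : ∀ x ∈ cube n S, f₀ x = jac x - h (updateFinset u₀ s (φ x)))
    (agree₁ : ∀ x ∈ cube n S, f₁ x = jac x - h (updateFinset u s (φ x))) {bH : ℝ}
    (hgap : ∀ x ∈ cube n S,
      coordGradient (fun x => f₁ x - f₀ x) x ⬝ᵥ coordGradient (fun x => f₁ x - f₀ x) x ≤ (bH * dev u) ^ 2)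
    {B : (s → G) → β → ℝ} {T : Finset β} (hBm : ∀ b ∈ T, Measurable fun y => B y b) {L : ℝ}
    (hBg : ∀ b ∈ T, ∃ g : (Fin n → ℝ) → ℝ, ContDiff ℝ 1 g ∧ (∀ x ∈ cube n S, g x = B (φ x) b) ∧
      ∀ x ∈ cube n S, coordGradient g x ⬝ᵥ coordGradient g x ≤ L ^ 2) :
    u ∈ respDom s χ h u₀ B T dev (bH / Real.sqrt lam) (L / Real.sqrt lam) := by
  have hS : 0 < S := hc.S_pos
  have hgm : Measurable (expGap s h u₀ u) :=
    (hhm.comp measurable_updateFinset).sub (hhm.comp measurable_updateFinset)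
  have hsq : (Real.sqrt lam) ^ 2 = lam := Real.sq_sqrt hlam.le
  refine ⟨hbl, ⟨K, hK⟩, hdev, fun θ hθ => ?_, fun b hb θ hθ => ?_⟩
  · rw [pathVar_eq_cubeVar hc hχm hhm hχ0 hC hK agree₀ agree₁ hgm]
    have hcongr : cubeVar (fun x => (1 - θ) * f₀ x + θ * f₁ x) S (fun x => expGap s h u₀ u (φ x)) =
        cubeVar (fun x => (1 - θ) * f₀ x + θ * f₁ x) S (fun x => f₁ x - f₀ x) :=
      cubeVar_congr_on fun x hx => by rw [expGap_apply, agree₀ x hx, agree₁ x hx]; ring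
    rw [hcongr]
    refine (cubeVar_le_of_grad_le hS hlam (contDiff_combo hf₀ hf₁ _ _)
      (hessianBound_interp_Icc hf₀ hf₁ hB₀ hB₁ hθ) ((hf₁.sub hf₀).of_le one_le_two) hgap).trans_eq ?_
    rw [div_mul_eq_mul_div, div_pow, hsq, inv_mul_eq_div]
  · obtain ⟨g, hg, hgB, hgL⟩ := hBg b hb
    rw [pathVar_eq_cubeVar hc hχm hhm hχ0 hC hK agree₀ agree₁ (hBm b hb)]
    have hcongr : cubeVar (fun x => (1 - θ) * f₀ x + θ * f₁ x) S (fun x => B (φ x) b) =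
        cubeVar (fun x => (1 - θ) * f₀ x + θ * f₁ x) S g :=
      cubeVar_congr_on fun x hx => (hgB x hx).symm
    rw [hcongr]
    refine (cubeVar_le_of_grad_le hS hlam (contDiff_combo hf₀ hf₁ _ _)
      (hessianBound_interp_Icc hf₀ hf₁ hB₀ hB₁ hθ) hg hgL).trans_eq ?_
    rw [div_pow, hsq, inv_mul_eq_div]

end Fibre

/-! ## §3  (v1.1, APPEND-ONLY over v1 p185004: the declarations of §1–§2 unchanged) Monotonicity and closure of
`respDom` in `(σ, τ)` — the `ε ↓ 0` step of caveat (EXT)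

The extension lemma behind (EXT) (a `λ`-convex `C²` exponent near the compact cube has, for every `λ' < λ`, a GLOBAL
`C²` representative with `HessianBound _ λ'` agreeing on the cube; pointer arXiv:1501.05226 = Azagra–Mudarra,
doi:10.1007/s00526-019-1542-z, chunk 4 of the held tex-layer text `paper-arxiv-1501.05226/p0004.txt` L7 — a chunk
index, not PDF page 4; not typed here)
loses an arbitrarily small amount of convexity.  Nothing is lost in the conclusion: the two variance slots of
`T4CovarianceResponse.respDom` are CLOSED conditions in `(σ, τ)` and the other three conjuncts do not involve them, so
membership for every `λ' ∈ (0, λ)` (from `mem_respDom_of_cubeChart` at `λ'`) gives membership at `λ`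
(`mem_respDom_of_forall_lt_modulus`).  Pure bookkeeping on `respDom`; [folklore]; NOT summit progress. -/

section Closure

variable {P : Params} {j : ℕ} {G : Type*} [GaugeGroup G] [MeasurableSpace G] [HaarData G]
variable [DecidableEq (PBond P j)]
variable {E : Type*} [NormedAddCommGroup E] [NormedSpace ℝ E]
variable {β : Type*} {s : Finset (PBond P j)} {χ h : Density P j G} {u₀ u : GaugeField P j G}
  {B : (s → G) → β → E} {T : Finset β} {dev : GaugeField P j G → ℝ}

/-- `respDom` is monotone in `(σ, τ)` (for `0 ≤ σ`, `0 ≤ τ`): weaker variance ceilings admit more exteriors.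
[folklore] -/
theorem respDom_mono {σ σ' τ τ' : ℝ} (hσ : 0 ≤ σ) (hσσ' : σ ≤ σ') (hτ : 0 ≤ τ) (hττ' : τ ≤ τ') :
    respDom s χ h u₀ B T dev σ τ ⊆ respDom s χ h u₀ B T dev σ' τ' := by
  intro v hv
  rw [respDom, Set.mem_setOf_eq] at hv ⊢
  obtain ⟨hbl, hK, hdev, hgap, hB⟩ := hv
  refine ⟨hbl, hK, hdev, fun θ hθ => (hgap θ hθ).trans ?_, fun b hb θ hθ => (hB b hb θ hθ).trans ?_⟩
  · exact pow_le_pow_left₀ (mul_nonneg hσ hdev) (mul_le_mul_of_nonneg_right hσσ' hdev) 2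
  · exact pow_le_pow_left₀ hτ hττ' 2

open Filter Topology in
/-- **Closure in `(σ, τ)`.**  If `u ∈ respDom … σ' τ'` for all `σ' > σ` and all `τ' > τ`, then
`u ∈ respDom … σ τ`: the variance slots `pathVar … ≤ (σ'·dev u)²`, `≤ τ'²` pass to the limit `σ' ↓ σ`, `τ' ↓ τ`.
[folklore] -/
theorem mem_respDom_of_forall_gt {σ τ : ℝ}
    (hmem : ∀ σ' τ' : ℝ, σ < σ' → τ < τ' → u ∈ respDom s χ h u₀ B T dev σ' τ') :
    u ∈ respDom s χ h u₀ B T dev σ τ := by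
  have h1 := hmem (σ + 1) (τ + 1) (lt_add_one σ) (lt_add_one τ)
  rw [respDom, Set.mem_setOf_eq] at h1 ⊢
  obtain ⟨hbl, hK, hdev, -, -⟩ := h1
  have hgapσ : ∀ σ' : ℝ, σ < σ' → ∀ θ ∈ Set.Icc (0 : ℝ) 1,
      pathVar s χ h u₀ u (expGap s h u₀ u) θ ≤ (σ' * dev u) ^ 2 := fun σ' hlt => by
    have hm := hmem σ' (τ + 1) hlt (lt_add_one τ)
    rw [respDom, Set.mem_setOf_eq] at hm
    exact hm.2.2.2.1
  have hBτ : ∀ τ' : ℝ, τ < τ' → ∀ b ∈ T, ∀ θ ∈ Set.Icc (0 : ℝ) 1,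
      pathVar s χ h u₀ u (fun y => B y b) θ ≤ τ' ^ 2 := fun τ' hlt => by
    have hm := hmem (σ + 1) τ' (lt_add_one σ) hlt
    rw [respDom, Set.mem_setOf_eq] at hm
    exact hm.2.2.2.2
  refine ⟨hbl, hK, hdev, fun θ hθ => ?_, fun b hb θ hθ => ?_⟩
  · have ht : Tendsto (fun σ' : ℝ => (σ' * dev u) ^ 2) (𝓝[>] σ) (𝓝 ((σ * dev u) ^ 2)) :=
      (((continuous_id.mul continuous_const).pow 2).continuousAt).continuousWithinAt.tendsto
    exact ge_of_tendsto ht (eventually_nhdsWithin_of_forall fun σ' hσ' => hgapσ σ' hσ' θ hθ)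
  · have ht : Tendsto (fun τ' : ℝ => τ' ^ 2) (𝓝[>] τ) (𝓝 (τ ^ 2)) :=
      ((continuous_id.pow 2).continuousAt).continuousWithinAt.tendsto
    exact ge_of_tendsto ht (eventually_nhdsWithin_of_forall fun τ' hτ' => hBτ τ' hτ' b hb θ hθ)

open Filter Topology in
/-- **The `ε ↓ 0` step of (EXT).**  If `u ∈ respDom … (bH/√λ') (L/√λ')` for every `λ' ∈ (0, λ)` — e.g. from
`mem_respDom_of_cubeChart` applied with `λ'`-convex global representatives for each `λ' < λ` — then
`u ∈ respDom … (bH/√λ) (L/√λ)` (`0 < λ`, `0 ≤ bH`, `0 ≤ L`). [folklore] -/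
theorem mem_respDom_of_forall_lt_modulus {lam bH L : ℝ} (hlam : 0 < lam) (hbH : 0 ≤ bH) (hL : 0 ≤ L)
    (hmem : ∀ lam' ∈ Set.Ioo 0 lam,
      u ∈ respDom s χ h u₀ B T dev (bH / Real.sqrt lam') (L / Real.sqrt lam')) :
    u ∈ respDom s χ h u₀ B T dev (bH / Real.sqrt lam) (L / Real.sqrt lam) := by
  refine mem_respDom_of_forall_gt fun σ' τ' hσ' hτ' => ?_
  have hsq : Real.sqrt lam ≠ 0 := (Real.sqrt_pos.2 hlam).ne'
  have hσt : Tendsto (fun x : ℝ => bH / Real.sqrt x) (𝓝[<] lam) (𝓝 (bH / Real.sqrt lam)) :=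
    (continuousAt_const.div Real.continuous_sqrt.continuousAt hsq).continuousWithinAt.tendsto
  have hτt : Tendsto (fun x : ℝ => L / Real.sqrt x) (𝓝[<] lam) (𝓝 (L / Real.sqrt lam)) :=
    (continuousAt_const.div Real.continuous_sqrt.continuousAt hsq).continuousWithinAt.tendsto
  have hev : ∀ᶠ x in 𝓝[<] lam, bH / Real.sqrt x < σ' ∧ L / Real.sqrt x < τ' ∧ 0 < x ∧ x < lam :=
    (hσt.eventually (gt_mem_nhds hσ')).and ((hτt.eventually (gt_mem_nhds hτ')).and
      (((lt_mem_nhds hlam).filter_mono nhdsWithin_le_nhds).and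
        (eventually_nhdsWithin_of_forall fun x hx => hx)))
  obtain ⟨x, hxσ, hxτ, hx0, hxl⟩ := hev.exists
  exact respDom_mono (div_nonneg hbH (Real.sqrt_nonneg _)) hxσ.le (div_nonneg hL (Real.sqrt_nonneg _)) hxτ.le
    (hmem x ⟨hx0, hxl⟩)

end Closure

/-! ## §4  (v1.3, APPEND-ONLY over v1.2 p185464: the declarations of §1–§3 unchanged) Vector inserts reduce
componentwise — caveat (REAL) typed

`T4CovarianceResponse.respDom` and `meanLipschitz_of_varianceBound` allow inserts with values in any real Banach space
`E`, while the cube engine of §2 bounds path variances of REAL inserts.  For a finite family of continuous linear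
functionals `ℓ i : E →L[ℝ] ℝ` DOMINATING THE NORM SQUARE (`‖v‖² ≤ c·Σ_i (ℓ i v)²`; Euclidean or sup-norm coordinates:
`c = 1`) and a BOUNDED a.e.-strongly-measurable insert `F`, the Bochner mean commutes with each `ℓ i`
(`ContinuousLinearMap.integral_comp_comm`), so pointwise `‖F − E_θF‖² ≤ c·Σ_i (ℓ i∘F − E_θ(ℓ i∘F))²` and, integrating
against the (probability) interpolant law, `Var_θ F ≤ c·Σ_i Var_θ(ℓ i∘F)`.  Hence membership in `respDom` for the
scalar component inserts gives membership for the vector inserts with the insert modulus multiplied by `√(c·#ι)`, and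
the plug of §2 extends to vector inserts component by component.  The window-mass proviso `fibreIntegral … u₀ ≠ 0` of
`T4CovarianceResponse` enters here (finiteness of the interpolant laws), as does a uniform bound on the inserts. -/

section Vector

variable {X : Type*} [MeasurableSpace X] {ν : Measure X} {q₀ g : X → ℝ}
variable {E : Type*} [NormedAddCommGroup E] [NormedSpace ℝ E]
variable {ι : Type*} [Fintype ι]

/-- NORM-SQUARE DOMINATION of a real normed space `E` by a finite family of continuous linear functionals `ℓ i` with
constant `c`: `‖v‖² ≤ c·Σ_i (ℓ i v)²` for every `v` (coordinates of `EuclideanSpace ℝ ι` or of `ι → ℝ`: `c = 1`,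
`normSqDominated_euclidean` / `normSqDominated_pi`; any basis of a finite-dimensional space: some `c`). [folklore] -/
def NormSqDominated (ℓ : ι → E →L[ℝ] ℝ) (c : ℝ) : Prop :=
  ∀ v : E, ‖v‖ ^ 2 ≤ c * ∑ i, (ℓ i v) ^ 2

/-- Euclidean coordinates dominate (indeed reproduce) the norm square with constant `1`. [folklore] -/
theorem normSqDominated_euclidean (ι : Type*) [Fintype ι] :
    NormSqDominated (fun i => (EuclideanSpace.proj i : EuclideanSpace ℝ ι →L[ℝ] ℝ)) 1 := fun v => by
  rw [one_mul, EuclideanSpace.real_norm_sq_eq]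
  exact le_of_eq (Finset.sum_congr rfl fun i _ => rfl)

/-- Euclidean coordinates reproduce the norm square exactly. [folklore] -/
theorem norm_sq_eq_sum_euclidean (v : EuclideanSpace ℝ ι) :
    ‖v‖ ^ 2 = ∑ i, ((EuclideanSpace.proj i : EuclideanSpace ℝ ι →L[ℝ] ℝ) v) ^ 2 := by
  rw [EuclideanSpace.real_norm_sq_eq]
  exact Finset.sum_congr rfl fun i _ => rfl

/-- Sup-norm coordinates of `ι → ℝ` dominate the norm square with constant `1`: `‖v‖∞² ≤ Σ_i v_i²`. [folklore] -/
theorem normSqDominated_pi (ι : Type*) [Fintype ι] :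
    NormSqDominated (fun i => (ContinuousLinearMap.proj i : (ι → ℝ) →L[ℝ] ℝ)) 1 := fun v => by
  rw [one_mul]
  have hsum : (0 : ℝ) ≤ ∑ i, (v i) ^ 2 := Finset.sum_nonneg fun j _ => sq_nonneg (v j)
  have h : ‖v‖ ≤ Real.sqrt (∑ i, (v i) ^ 2) := by
    refine (pi_norm_le_iff_of_nonneg (Real.sqrt_nonneg _)).2 fun i => ?_
    rw [Real.norm_eq_abs]
    exact Real.abs_le_sqrt (Finset.single_le_sum (fun j _ => sq_nonneg (v j)) (Finset.mem_univ i))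
  calc ‖v‖ ^ 2 ≤ (Real.sqrt (∑ i, (v i) ^ 2)) ^ 2 := by gcongr
    _ = ∑ i, (v i) ^ 2 := Real.sq_sqrt hsum
    _ = ∑ i, ((ContinuousLinearMap.proj i : (ι → ℝ) →L[ℝ] ℝ) v) ^ 2 := Finset.sum_congr rfl fun i _ => rfl

omit [NormedSpace ℝ E] in
/-- A bounded a.e.-strongly-measurable insert is integrable under every interpolant law. [folklore] -/
theorem integrable_tiltLaw_of_bound [IsFiniteMeasure ν] (h : TiltData ν q₀ g) {F : X → E}
    (hF : AEStronglyMeasurable F ν) {R : ℝ} (hR : ∀ x, ‖F x‖ ≤ R) (θ : ℝ) :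
    Integrable F (tiltLaw ν q₀ g θ) := by
  haveI := isProbabilityMeasure_tiltLaw h θ
  exact (memLp_top_of_bound (hF.mono_ac (tiltLaw_absolutelyContinuous ν q₀ g θ)) R (ae_of_all _ hR)).integrable
    le_top

variable [CompleteSpace E]

/-- Continuous linear functionals commute with the tilted mean of a bounded insert: `ℓ(E_θ F) = E_θ(ℓ∘F)`. [folklore] -/
theorem apply_tiltMean_eq [IsFiniteMeasure ν] (h : TiltData ν q₀ g) (ℓ : E →L[ℝ] ℝ) {F : X → E}
    (hF : AEStronglyMeasurable F ν) {R : ℝ} (hR : ∀ x, ‖F x‖ ≤ R) (θ : ℝ) :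
    ℓ (tiltMean ν q₀ g F θ) = tiltMean ν q₀ g (fun x => ℓ (F x)) θ := by
  rw [tiltMean, tiltMean, ← ContinuousLinearMap.integral_comp_comm ℓ (integrable_tiltLaw_of_bound h hF hR θ)]

omit [CompleteSpace E] in
/-- The squared deviation of a scalar component of a bounded insert from its tilted mean is integrable under the
interpolant law. [folklore] -/
theorem integrable_sq_dev_apply [IsFiniteMeasure ν] (h : TiltData ν q₀ g) (ℓ : E →L[ℝ] ℝ) {F : X → E}
    (hF : AEStronglyMeasurable F ν) {R : ℝ} (hR : ∀ x, ‖F x‖ ≤ R) (θ : ℝ) :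
    Integrable (fun x => ‖ℓ (F x) - tiltMean ν q₀ g (fun x => ℓ (F x)) θ‖ ^ 2) (tiltLaw ν q₀ g θ) := by
  haveI := isProbabilityMeasure_tiltLaw h θ
  have hFμ : AEStronglyMeasurable F (tiltLaw ν q₀ g θ) := hF.mono_ac (tiltLaw_absolutelyContinuous ν q₀ g θ)
  have hmeas : AEStronglyMeasurable (fun x => ℓ (F x) - tiltMean ν q₀ g (fun x => ℓ (F x)) θ) (tiltLaw ν q₀ g θ) :=
    (ℓ.continuous.comp_aestronglyMeasurable hFμ).sub aestronglyMeasurable_const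
  have hbd : ∀ x, ‖ℓ (F x) - tiltMean ν q₀ g (fun x => ℓ (F x)) θ‖ ≤
      ‖ℓ‖ * R + ‖tiltMean ν q₀ g (fun x => ℓ (F x)) θ‖ := fun x =>
    (norm_sub_le _ _).trans (add_le_add ((ℓ.le_opNorm _).trans
      (mul_le_mul_of_nonneg_left (hR x) (norm_nonneg _))) le_rfl)
  refine (memLp_top_of_bound ((continuous_pow 2).comp_aestronglyMeasurable hmeas.norm)
    ((‖ℓ‖ * R + ‖tiltMean ν q₀ g (fun x => ℓ (F x)) θ‖) ^ 2) (ae_of_all _ fun x => ?_)).integrable le_top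
  rw [Real.norm_eq_abs, abs_pow, abs_norm]
  gcongr
  exact hbd x

/-- **COMPONENTWISE REDUCTION OF THE PATH VARIANCE (inequality form).**  If the functionals `ℓ i` dominate the norm
square of `E` with constant `c`, then for a bounded a.e.-strongly-measurable insert `F` and every `θ`:
`Var_θ(F) ≤ c·Σ_i Var_θ(ℓ i ∘ F)`. [folklore] -/
theorem tiltVar_le_sum_apply [IsFiniteMeasure ν] (h : TiltData ν q₀ g) {ℓ : ι → E →L[ℝ] ℝ} {c : ℝ}
    (hℓ : NormSqDominated ℓ c) {F : X → E} (hF : AEStronglyMeasurable F ν) {R : ℝ} (hR : ∀ x, ‖F x‖ ≤ R)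
    (θ : ℝ) : tiltVar ν q₀ g F θ ≤ c * ∑ i, tiltVar ν q₀ g (fun x => ℓ i (F x)) θ := by
  have hmean : ∀ i, ℓ i (tiltMean ν q₀ g F θ) = tiltMean ν q₀ g (fun x => ℓ i (F x)) θ :=
    fun i => apply_tiltMean_eq h (ℓ i) hF hR θ
  have hpt : ∀ x, ‖F x - tiltMean ν q₀ g F θ‖ ^ 2 ≤
      c * ∑ i, ‖ℓ i (F x) - tiltMean ν q₀ g (fun x => ℓ i (F x)) θ‖ ^ 2 := by
    intro x
    refine (hℓ _).trans (le_of_eq ?_)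
    congr 1
    refine Finset.sum_congr rfl fun i _ => ?_
    rw [map_sub, hmean i, Real.norm_eq_abs, sq_abs]
  have hint : ∀ i, Integrable (fun x => ‖ℓ i (F x) - tiltMean ν q₀ g (fun x => ℓ i (F x)) θ‖ ^ 2)
      (tiltLaw ν q₀ g θ) := fun i => integrable_sq_dev_apply h (ℓ i) hF hR θ
  calc tiltVar ν q₀ g F θ
      ≤ ∫ x, c * ∑ i, ‖ℓ i (F x) - tiltMean ν q₀ g (fun x => ℓ i (F x)) θ‖ ^ 2 ∂tiltLaw ν q₀ g θ :=
        integral_mono_of_nonneg (ae_of_all _ fun x => sq_nonneg _)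
          ((integrable_finsetSum _ fun i _ => hint i).const_mul c) (ae_of_all _ hpt)
    _ = c * ∑ i, tiltVar ν q₀ g (fun x => ℓ i (F x)) θ := by
        rw [integral_const_mul, integral_finsetSum _ fun i _ => hint i]
        rfl

/-- **COMPONENTWISE REDUCTION OF THE PATH VARIANCE (equality form).**  If the functionals `ℓ i` reproduce the norm
square of `E` exactly (`‖v‖² = Σ_i (ℓ i v)²`, e.g. Euclidean coordinates), then `Var_θ(F) = Σ_i Var_θ(ℓ i ∘ F)` for a
bounded a.e.-strongly-measurable insert `F`. [folklore] -/
theorem tiltVar_eq_sum_apply [IsFiniteMeasure ν] (h : TiltData ν q₀ g) {ℓ : ι → E →L[ℝ] ℝ}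
    (hℓ : ∀ v : E, ‖v‖ ^ 2 = ∑ i, (ℓ i v) ^ 2) {F : X → E} (hF : AEStronglyMeasurable F ν) {R : ℝ}
    (hR : ∀ x, ‖F x‖ ≤ R) (θ : ℝ) :
    tiltVar ν q₀ g F θ = ∑ i, tiltVar ν q₀ g (fun x => ℓ i (F x)) θ := by
  have hmean : ∀ i, ℓ i (tiltMean ν q₀ g F θ) = tiltMean ν q₀ g (fun x => ℓ i (F x)) θ :=
    fun i => apply_tiltMean_eq h (ℓ i) hF hR θ
  have hpt : ∀ x, ‖F x - tiltMean ν q₀ g F θ‖ ^ 2 =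
      ∑ i, ‖ℓ i (F x) - tiltMean ν q₀ g (fun x => ℓ i (F x)) θ‖ ^ 2 := by
    intro x
    rw [hℓ]
    refine Finset.sum_congr rfl fun i _ => ?_
    rw [map_sub, hmean i, Real.norm_eq_abs, sq_abs]
  have hint : ∀ i, Integrable (fun x => ‖ℓ i (F x) - tiltMean ν q₀ g (fun x => ℓ i (F x)) θ‖ ^ 2)
      (tiltLaw ν q₀ g θ) := fun i => integrable_sq_dev_apply h (ℓ i) hF hR θ
  calc tiltVar ν q₀ g F θ
      = ∫ x, ∑ i, ‖ℓ i (F x) - tiltMean ν q₀ g (fun x => ℓ i (F x)) θ‖ ^ 2 ∂tiltLaw ν q₀ g θ :=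
        integral_congr_ae (ae_of_all _ hpt)
    _ = ∑ i, tiltVar ν q₀ g (fun x => ℓ i (F x)) θ := by
        rw [integral_finsetSum _ fun i _ => hint i]
        rfl

/-- The variance of each scalar component is at most `‖ℓ‖²` times the variance of the vector insert:
`Var_θ(ℓ∘F) ≤ ‖ℓ‖²·Var_θ(F)`. [folklore] -/
theorem tiltVar_apply_le [IsFiniteMeasure ν] (h : TiltData ν q₀ g) (ℓ : E →L[ℝ] ℝ) {F : X → E}
    (hF : AEStronglyMeasurable F ν) {R : ℝ} (hR : ∀ x, ‖F x‖ ≤ R) {θ : ℝ}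
    (hint : Integrable (fun x => ‖F x - tiltMean ν q₀ g F θ‖ ^ 2) (tiltLaw ν q₀ g θ)) :
    tiltVar ν q₀ g (fun x => ℓ (F x)) θ ≤ ‖ℓ‖ ^ 2 * tiltVar ν q₀ g F θ := by
  have hmean : ℓ (tiltMean ν q₀ g F θ) = tiltMean ν q₀ g (fun x => ℓ (F x)) θ :=
    apply_tiltMean_eq h ℓ hF hR θ
  calc tiltVar ν q₀ g (fun x => ℓ (F x)) θ
      ≤ ∫ x, ‖ℓ‖ ^ 2 * ‖F x - tiltMean ν q₀ g F θ‖ ^ 2 ∂tiltLaw ν q₀ g θ := by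
        refine integral_mono_of_nonneg (ae_of_all _ fun x => sq_nonneg _) (hint.const_mul _)
          (ae_of_all _ fun x => ?_)
        show ‖ℓ (F x) - tiltMean ν q₀ g (fun x => ℓ (F x)) θ‖ ^ 2 ≤ ‖ℓ‖ ^ 2 * ‖F x - tiltMean ν q₀ g F θ‖ ^ 2
        rw [← hmean, ← map_sub, ← mul_pow]
        exact pow_le_pow_left₀ (norm_nonneg _) (ℓ.le_opNorm _) 2
    _ = ‖ℓ‖ ^ 2 * tiltVar ν q₀ g F θ := by rw [integral_const_mul]; rfl

end Vector

section FibreVec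

variable {P : Params} {j : ℕ} {G : Type*} [GaugeGroup G] [MeasurableSpace G] [HaarData G]
variable [DecidableEq (PBond P j)]
variable {E : Type*} [NormedAddCommGroup E] [NormedSpace ℝ E] [CompleteSpace E]
variable {ι : Type*} [Fintype ι]
variable {s : Finset (PBond P j)} {χ h : Density P j G} {u₀ u : GaugeField P j G}

/-- COMPONENTWISE REDUCTION OF `pathVar` on the one-step fibre: for `C`-bounded measurable Gibbs data with the printed
proviso at `u₀`, a `K`-bounded gap and a bounded a.e.-strongly-measurable insert `F`:
`pathVar … F θ ≤ c·Σ_i pathVar … (ℓ i ∘ F) θ`. [folklore] -/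
theorem pathVar_le_sum_apply (hχm : Measurable χ) (hhm : Measurable h) (hχ0 : ∀ U, 0 ≤ χ U) {C : ℝ}
    (hC : ∀ U, χ U * Real.exp (h U) ≤ C) (hne : fibreIntegral s (fun U => χ U * Real.exp (h U)) u₀ ≠ 0) {K : ℝ}
    (hK : ∀ y : s → G, |h (updateFinset u₀ s y) - h (updateFinset u s y)| ≤ K) {ℓ : ι → E →L[ℝ] ℝ} {c : ℝ}
    (hℓ : NormSqDominated ℓ c) {F : (s → G) → E} (hF : AEStronglyMeasurable F (fibreBase s)) {R : ℝ}
    (hR : ∀ y, ‖F y‖ ≤ R) (θ : ℝ) :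
    pathVar s χ h u₀ u F θ ≤ c * ∑ i, pathVar s χ h u₀ u (fun y => ℓ i (F y)) θ :=
  tiltVar_le_sum_apply (tiltData_fibre s hχm hhm hχ0 hC hne hK) hℓ hF hR θ

/-- … and the equality form for norm-reproducing coordinates. [folklore] -/
theorem pathVar_eq_sum_apply (hχm : Measurable χ) (hhm : Measurable h) (hχ0 : ∀ U, 0 ≤ χ U) {C : ℝ}
    (hC : ∀ U, χ U * Real.exp (h U) ≤ C) (hne : fibreIntegral s (fun U => χ U * Real.exp (h U)) u₀ ≠ 0) {K : ℝ}
    (hK : ∀ y : s → G, |h (updateFinset u₀ s y) - h (updateFinset u s y)| ≤ K) {ℓ : ι → E →L[ℝ] ℝ}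
    (hℓ : ∀ v : E, ‖v‖ ^ 2 = ∑ i, (ℓ i v) ^ 2) {F : (s → G) → E} (hF : AEStronglyMeasurable F (fibreBase s))
    {R : ℝ} (hR : ∀ y, ‖F y‖ ≤ R) (θ : ℝ) :
    pathVar s χ h u₀ u F θ = ∑ i, pathVar s χ h u₀ u (fun y => ℓ i (F y)) θ :=
  tiltVar_eq_sum_apply (tiltData_fibre s hχm hhm hχ0 hC hne hK) hℓ hF hR θ

/-- **VECTOR INSERTS FROM THEIR COMPONENTS (caveat (REAL) of the header, typed).**  If `u` lies in the response
domain for the SCALAR component inserts `(b, i) ↦ ℓ i (B · b)` over `T ×ˢ univ` with insert modulus `τ`, and the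
`ℓ i` dominate the norm square of `E` with constant `c ≥ 0`, then `u` lies in the response domain for the
`E`-valued inserts `B · b` (`b ∈ T`, bounded, a.e.-strongly measurable) with insert modulus `√(c·#ι)·τ`; the other
four membership conditions do not involve the inserts. [folklore] -/
theorem mem_respDom_of_apply {β : Type*} (hχm : Measurable χ) (hhm : Measurable h) (hχ0 : ∀ U, 0 ≤ χ U) {C : ℝ}
    (hC : ∀ U, χ U * Real.exp (h U) ≤ C) (hne : fibreIntegral s (fun U => χ U * Real.exp (h U)) u₀ ≠ 0)
    {ℓ : ι → E →L[ℝ] ℝ} {c : ℝ} (hℓ : NormSqDominated ℓ c) (hc : 0 ≤ c) {B : (s → G) → β → E} {T : Finset β}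
    (hBa : ∀ b ∈ T, AEStronglyMeasurable (fun y => B y b) (fibreBase s)) {R : ℝ} (hR : ∀ b ∈ T, ∀ y, ‖B y b‖ ≤ R)
    {dev : GaugeField P j G → ℝ} {σ τ : ℝ}
    (hu : u ∈ respDom s χ h u₀ (fun y (bi : β × ι) => ℓ bi.2 (B y bi.1)) (T ×ˢ Finset.univ) dev σ τ) :
    u ∈ respDom s χ h u₀ B T dev σ (Real.sqrt (c * Fintype.card ι) * τ) := by
  obtain ⟨hbl, ⟨K, hK⟩, hdev, hVg, hVF⟩ := hu
  refine ⟨hbl, ⟨K, hK⟩, hdev, hVg, fun b hb θ hθ => ?_⟩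
  calc pathVar s χ h u₀ u (fun y => B y b) θ ≤ c * ∑ i, pathVar s χ h u₀ u (fun y => ℓ i (B y b)) θ :=
        pathVar_le_sum_apply hχm hhm hχ0 hC hne hK hℓ (hBa b hb) (hR b hb) θ
    _ ≤ c * ∑ _i : ι, τ ^ 2 := by
        gcongr with i
        exact hVF (b, i) (Finset.mk_mem_product hb (Finset.mem_univ i)) θ hθ
    _ = (Real.sqrt (c * Fintype.card ι) * τ) ^ 2 := by
        rw [Finset.sum_const, Finset.card_univ, nsmul_eq_mul, mul_pow, Real.sq_sqrt (by positivity)]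
        ring

/-- Conversely, membership for the vector inserts gives membership for each scalar component insert with modulus
`‖ℓ i‖`-scaled: `u ∈ respDom … B T dev σ τ → u ∈ respDom … (b,i) ↦ ℓ i (B·b) … σ (M·τ)` whenever `‖ℓ i‖ ≤ M`.
[folklore] -/
theorem mem_respDom_apply_of_mem {β : Type*} (hχm : Measurable χ) (hhm : Measurable h) (hχ0 : ∀ U, 0 ≤ χ U)
    {C : ℝ} (hC : ∀ U, χ U * Real.exp (h U) ≤ C) (hne : fibreIntegral s (fun U => χ U * Real.exp (h U)) u₀ ≠ 0)
    {ℓ : ι → E →L[ℝ] ℝ} {M : ℝ} (hM : ∀ i, ‖ℓ i‖ ≤ M) {B : (s → G) → β → E} {T : Finset β}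
    (hBa : ∀ b ∈ T, AEStronglyMeasurable (fun y => B y b) (fibreBase s)) {R : ℝ} (hR : ∀ b ∈ T, ∀ y, ‖B y b‖ ≤ R)
    {dev : GaugeField P j G → ℝ} {σ τ : ℝ} (hu : u ∈ respDom s χ h u₀ B T dev σ τ) :
    u ∈ respDom s χ h u₀ (fun y (bi : β × ι) => ℓ bi.2 (B y bi.1)) (T ×ˢ Finset.univ) dev σ (M * τ) := by
  obtain ⟨hbl, ⟨K, hK⟩, hdev, hVg, hVF⟩ := hu
  refine ⟨hbl, ⟨K, hK⟩, hdev, hVg, fun bi hbi θ hθ => ?_⟩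
  obtain ⟨hb, -⟩ := Finset.mem_product.1 hbi
  have hT := tiltData_fibre s hχm hhm hχ0 hC hne hK
  haveI : IsProbabilityMeasure (pathLaw s χ h u₀ u θ) := isProbabilityMeasure_tiltLaw hT θ
  set m : E := tiltMean (fibreBase s) (fibreDensity s (fun U => χ U * Real.exp (h U)) u₀) (expGap s h u₀ u)
    (fun y => B y bi.1) θ with hm
  have hint : Integrable (fun y => ‖B y bi.1 - m‖ ^ 2) (pathLaw s χ h u₀ u θ) := by
    have hFμ : AEStronglyMeasurable (fun y => B y bi.1) (pathLaw s χ h u₀ u θ) :=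
      (hBa _ hb).mono_ac (tiltLaw_absolutelyContinuous _ _ _ θ)
    have hmeas : AEStronglyMeasurable (fun y => ‖B y bi.1 - m‖) (pathLaw s χ h u₀ u θ) :=
      (hFμ.sub aestronglyMeasurable_const).norm
    refine (memLp_top_of_bound ((continuous_pow 2).comp_aestronglyMeasurable hmeas) ((R + ‖m‖) ^ 2)
      (ae_of_all _ fun y => ?_)).integrable le_top
    rw [Real.norm_eq_abs, abs_pow, abs_norm]
    gcongr
    exact (norm_sub_le _ _).trans (add_le_add (hR _ hb y) le_rfl)
  have hV0 : 0 ≤ pathVar s χ h u₀ u (fun y => B y bi.1) θ := integral_nonneg fun _ => sq_nonneg _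
  calc pathVar s χ h u₀ u (fun y => ℓ bi.2 (B y bi.1)) θ
      ≤ ‖ℓ bi.2‖ ^ 2 * pathVar s χ h u₀ u (fun y => B y bi.1) θ :=
        tiltVar_apply_le hT (ℓ bi.2) (hBa _ hb) (hR _ hb) hint
    _ ≤ M ^ 2 * τ ^ 2 :=
        mul_le_mul (pow_le_pow_left₀ (norm_nonneg _) (hM bi.2) 2) (hVF bi.1 hb θ hθ) hV0 (sq_nonneg M)
    _ = (M * τ) ^ 2 := by ring

variable {n : ℕ} {S : ℝ} {φ : (Fin n → ℝ) → (s → G)} {jac : (Fin n → ℝ) → ℝ}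

/-- **THE PLUG FOR VECTOR INSERTS.**  `mem_respDom_of_cubeChart` applied to the scalar component inserts
`(b, i) ↦ ℓ i (B · b)` (each with a `C¹` representative on the cube with `|∇|² ≤ L²`), followed by
`mem_respDom_of_apply`: `u ∈ respDom s χ h u₀ B T dev (b_H/√λ) (√(c·#ι)·(L/√λ))` for bounded a.e.-strongly-measurable
`E`-valued inserts whose components are measurable. [folklore] -/
theorem mem_respDom_of_cubeChart_apply {β : Type*} (hc : CubeChart s χ u₀ n S φ jac) (hχm : Measurable χ)
    (hhm : Measurable h) (hχ0 : ∀ U, 0 ≤ χ U) {C : ℝ} (hC : ∀ U, χ U * Real.exp (h U) ≤ C)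
    (hne : fibreIntegral s (fun U => χ U * Real.exp (h U)) u₀ ≠ 0)
    (hbl : ∀ y : s → G, χ (updateFinset u s y) = χ (updateFinset u₀ s y)) {K : ℝ}
    (hK : ∀ y : s → G, |h (updateFinset u₀ s y) - h (updateFinset u s y)| ≤ K) {dev : GaugeField P j G → ℝ}
    (hdev : 0 ≤ dev u) {lam : ℝ} (hlam : 0 < lam) {f₀ f₁ : (Fin n → ℝ) → ℝ} (hf₀ : ContDiff ℝ 2 f₀)
    (hf₁ : ContDiff ℝ 2 f₁) (hB₀ : HessianBound f₀ lam) (hB₁ : HessianBound f₁ lam)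
    (agree₀ : ∀ x ∈ cube n S, f₀ x = jac x - h (updateFinset u₀ s (φ x)))
    (agree₁ : ∀ x ∈ cube n S, f₁ x = jac x - h (updateFinset u s (φ x))) {bH : ℝ}
    (hgap : ∀ x ∈ cube n S,
      coordGradient (fun x => f₁ x - f₀ x) x ⬝ᵥ coordGradient (fun x => f₁ x - f₀ x) x ≤ (bH * dev u) ^ 2)
    {ℓ : ι → E →L[ℝ] ℝ} {c : ℝ} (hℓ : NormSqDominated ℓ c) (hc0 : 0 ≤ c) {B : (s → G) → β → E} {T : Finset β}
    (hBa : ∀ b ∈ T, AEStronglyMeasurable (fun y => B y b) (fibreBase s))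
    (hBm : ∀ b ∈ T, ∀ i, Measurable fun y => ℓ i (B y b)) {R : ℝ} (hR : ∀ b ∈ T, ∀ y, ‖B y b‖ ≤ R) {L : ℝ}
    (hBg : ∀ b ∈ T, ∀ i, ∃ g : (Fin n → ℝ) → ℝ, ContDiff ℝ 1 g ∧ (∀ x ∈ cube n S, g x = ℓ i (B (φ x) b)) ∧
      ∀ x ∈ cube n S, coordGradient g x ⬝ᵥ coordGradient g x ≤ L ^ 2) :
    u ∈ respDom s χ h u₀ B T dev (bH / Real.sqrt lam) (Real.sqrt (c * Fintype.card ι) * (L / Real.sqrt lam)) :=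
  mem_respDom_of_apply hχm hhm hχ0 hC hne hℓ hc0 hBa hR
    (mem_respDom_of_cubeChart hc hχm hhm hχ0 hC hbl hK hdev hlam hf₀ hf₁ hB₀ hB₁ agree₀ agree₁ hgap
      (B := fun y (bi : β × ι) => ℓ bi.2 (B y bi.1)) (T := T ×ˢ Finset.univ)
      (fun bi hbi => hBm bi.1 (Finset.mem_product.1 hbi).1 bi.2)
      (fun bi hbi => hBg bi.1 (Finset.mem_product.1 hbi).1 bi.2))

/-- EUCLIDEAN INSERTS.  For `EuclideanSpace ℝ ι`-valued measurable bounded inserts the coordinate functionals reproduce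
the norm square (`c = 1`) and component measurability / a.e.-strong measurability come for free:
`u ∈ respDom … B T dev (b_H/√λ) (√#ι·(L/√λ))`. [folklore] -/
theorem mem_respDom_of_cubeChart_euclidean {β : Type*} (hc : CubeChart s χ u₀ n S φ jac) (hχm : Measurable χ)
    (hhm : Measurable h) (hχ0 : ∀ U, 0 ≤ χ U) {C : ℝ} (hC : ∀ U, χ U * Real.exp (h U) ≤ C)
    (hne : fibreIntegral s (fun U => χ U * Real.exp (h U)) u₀ ≠ 0)
    (hbl : ∀ y : s → G, χ (updateFinset u s y) = χ (updateFinset u₀ s y)) {K : ℝ}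
    (hK : ∀ y : s → G, |h (updateFinset u₀ s y) - h (updateFinset u s y)| ≤ K) {dev : GaugeField P j G → ℝ}
    (hdev : 0 ≤ dev u) {lam : ℝ} (hlam : 0 < lam) {f₀ f₁ : (Fin n → ℝ) → ℝ} (hf₀ : ContDiff ℝ 2 f₀)
    (hf₁ : ContDiff ℝ 2 f₁) (hB₀ : HessianBound f₀ lam) (hB₁ : HessianBound f₁ lam)
    (agree₀ : ∀ x ∈ cube n S, f₀ x = jac x - h (updateFinset u₀ s (φ x)))
    (agree₁ : ∀ x ∈ cube n S, f₁ x = jac x - h (updateFinset u s (φ x))) {bH : ℝ}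
    (hgap : ∀ x ∈ cube n S,
      coordGradient (fun x => f₁ x - f₀ x) x ⬝ᵥ coordGradient (fun x => f₁ x - f₀ x) x ≤ (bH * dev u) ^ 2)
    {B : (s → G) → β → EuclideanSpace ℝ ι} {T : Finset β} (hBm : ∀ b ∈ T, Measurable fun y => B y b) {R : ℝ}
    (hR : ∀ b ∈ T, ∀ y, ‖B y b‖ ≤ R) {L : ℝ}
    (hBg : ∀ b ∈ T, ∀ i, ∃ g : (Fin n → ℝ) → ℝ, ContDiff ℝ 1 g ∧ (∀ x ∈ cube n S, g x = B (φ x) b i) ∧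
      ∀ x ∈ cube n S, coordGradient g x ⬝ᵥ coordGradient g x ≤ L ^ 2) :
    u ∈ respDom s χ h u₀ B T dev (bH / Real.sqrt lam) (Real.sqrt (Fintype.card ι) * (L / Real.sqrt lam)) := by
  have key := mem_respDom_of_cubeChart_apply hc hχm hhm hχ0 hC hne hbl hK hdev hlam hf₀ hf₁ hB₀ hB₁ agree₀ agree₁
    hgap (normSqDominated_euclidean ι) zero_le_one (fun b hb => (hBm b hb).aestronglyMeasurable)
    (fun b hb i => (EuclideanSpace.proj i).continuous.measurable.comp (hBm b hb)) hR
    (L := L) (fun b hb i => hBg b hb i)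
  rwa [one_mul] at key

/-- SUP-NORM TUPLE INSERTS.  For `(ι → ℝ)`-valued measurable bounded inserts (sup norm) the coordinate functionals
dominate the norm square with `c = 1`: `u ∈ respDom … B T dev (b_H/√λ) (√#ι·(L/√λ))`. [folklore] -/
theorem mem_respDom_of_cubeChart_pi {β : Type*} (hc : CubeChart s χ u₀ n S φ jac) (hχm : Measurable χ)
    (hhm : Measurable h) (hχ0 : ∀ U, 0 ≤ χ U) {C : ℝ} (hC : ∀ U, χ U * Real.exp (h U) ≤ C)
    (hne : fibreIntegral s (fun U => χ U * Real.exp (h U)) u₀ ≠ 0)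
    (hbl : ∀ y : s → G, χ (updateFinset u s y) = χ (updateFinset u₀ s y)) {K : ℝ}
    (hK : ∀ y : s → G, |h (updateFinset u₀ s y) - h (updateFinset u s y)| ≤ K) {dev : GaugeField P j G → ℝ}
    (hdev : 0 ≤ dev u) {lam : ℝ} (hlam : 0 < lam) {f₀ f₁ : (Fin n → ℝ) → ℝ} (hf₀ : ContDiff ℝ 2 f₀)
    (hf₁ : ContDiff ℝ 2 f₁) (hB₀ : HessianBound f₀ lam) (hB₁ : HessianBound f₁ lam)
    (agree₀ : ∀ x ∈ cube n S, f₀ x = jac x - h (updateFinset u₀ s (φ x)))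
    (agree₁ : ∀ x ∈ cube n S, f₁ x = jac x - h (updateFinset u s (φ x))) {bH : ℝ}
    (hgap : ∀ x ∈ cube n S,
      coordGradient (fun x => f₁ x - f₀ x) x ⬝ᵥ coordGradient (fun x => f₁ x - f₀ x) x ≤ (bH * dev u) ^ 2)
    {B : (s → G) → β → (ι → ℝ)} {T : Finset β} (hBm : ∀ b ∈ T, Measurable fun y => B y b) {R : ℝ}
    (hR : ∀ b ∈ T, ∀ y, ‖B y b‖ ≤ R) {L : ℝ}
    (hBg : ∀ b ∈ T, ∀ i, ∃ g : (Fin n → ℝ) → ℝ, ContDiff ℝ 1 g ∧ (∀ x ∈ cube n S, g x = B (φ x) b i) ∧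
      ∀ x ∈ cube n S, coordGradient g x ⬝ᵥ coordGradient g x ≤ L ^ 2) :
    u ∈ respDom s χ h u₀ B T dev (bH / Real.sqrt lam) (Real.sqrt (Fintype.card ι) * (L / Real.sqrt lam)) := by
  have key := mem_respDom_of_cubeChart_apply hc hχm hhm hχ0 hC hne hbl hK hdev hlam hf₀ hf₁ hB₀ hB₁ agree₀ agree₁
    hgap (normSqDominated_pi ι) zero_le_one (fun b hb => (hBm b hb).aestronglyMeasurable)
    (fun b hb i => (measurable_pi_apply i).comp (hBm b hb)) hR (L := L) (fun b hb i => hBg b hb i)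
  rwa [one_mul] at key

end FibreVec

end Literature.MathematicalPhysics.QuantumFieldTheory.Balaban1983to89.T4CubeChartTransport

end
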